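import Mathlib
import HarnessLib
import Summits.AtomisticToContinuum.HydrodynamicLimit.Theorems.OneFlightGossipEngineKineticCurrentsLDAlongFamiliesLawChange

/-!
# Two-profile static change of measure between local Gibbs laws (stub `stub_twoProfileTransfer`,
# line `rare-band-ladder-dock` v7, crux `KineticWindowGronwall`, stmt-AtomisticToContinuum-9282)

For a temperature range `0 < θm ≤ θM` and a budget `δ > 0` there is `ρ > 0` such that for any two
continuous local Gibbs data `(aᵢ, θᵢ, uᵢ)` on `𝕋³` with `aᵢ > 0`, `θm ≤ θᵢ ≤ θM`, `ρ`-close in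
`(log a, θ, u)` pointwise, every `0 < σ ≤ 1/2`, `N`, flow `Φ` and measurable `G ≥ 0`:
`∫ G dλ₁ ≤ e^{δ(N+1)} (∫ G² dλ₂)^{1/2}`, `λᵢ = localGibbsLaw σ aᵢ uᵢ θᵢ N Φ`. No dynamics.

Proof. `λᵢ = ψᵢ dL`, `L` the Liouville measure, `ψᵢ` the canonical density of the profile
`fᵢ(x,v) = aᵢ(x) M_{1,uᵢ(x),θᵢ(x)}(v)`. CAUCHY–SCHWARZ in `ℝ≥0∞`: `ψ₂ > 0` on the hard-sphere
domain, which carries `L`, so `∫ G dλ₁ = ∫ (G ψ₂^{1/2}) (ψ₁ ψ₂^{-1/2}) dL ≤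
(∫ G² dλ₂)^{1/2} (∫ ψ₁² ψ₂⁻¹ dL)^{1/2}` — the landed `LawChange.lintegral_le_of_renyi_two`
(crux `KineticCurrentsLDAlongFamilies`, stub `stub_lawChangeFamily`). RÉNYI: the two-profile statics
of `stub_staticFreezing` — per particle `log f₁ − log f₂ ≤ e(5/2 + θm⁻¹) + e(1 + θm⁻¹)/2 · ‖v − u₁(x)‖²`,
`Z₂ ≤ e^{e(N+1)} Z₁`, the fibrewise Gaussian moment `(1 − 2sθM)^{-3/2}` and the tolerance
`e(p, δ, θm, θM)` of `StaticFreezing.exists_tolerance` — give `∫ ψ₁^p ψ₂^{1-p} dL ≤ e^{pδ(N+1)}`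
once the data `(log a, log θ, u, θ⁻¹)` differ by `< e` (the landed `LawChange.renyi_le_of_close`);
here (`twoProfile_renyi_le`) the four `< e` facts are derived from the `ρ`-closeness of
`(log a, θ, u)` on the range `[θm, θM]` with `ρ = min e (min (e θm) (e θm²)) / 2`, `log` being
`θm⁻¹`-Lipschitz (`log_sub_log_le_of_abs_sub_le`) and `θ ↦ θ⁻¹` being `θm⁻²`-Lipschitz
(`inv_sub_inv_le_of_abs_sub_le`) on `[θm, ∞)`. Finally `p = 2` and
`(e^{2δ(N+1)})^{1/2} = e^{δ(N+1)}` (`LawChange.ofReal_exp_mul_rpow_inv`).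

References: H. Spohn, *Large Scale Dynamics of Interacting Particles* (1991), Part I §2.3 (local
equilibrium states); folklore (Cauchy–Schwarz / order-2 Rényi change of measure).
-/

noncomputable section

open MeasureTheory Set Filter
open scoped ENNReal Topology
open Literature.Analysis.FluidPDE Literature.MathematicalPhysics.KineticTheory

namespace Summit.AtomisticToContinuum.HydrodynamicLimit.Theorems.KineticWindowGronwallTwoProfileTransfer

/-- The hard-sphere flow of `N+1` spheres at reduced density `σ` on `𝕋³`. -/
abbrev TFlow (σ : ℝ) (N : ℕ) : Type :=
  HardSphereFlow (Torus.geometry (Fin 3)) (hsDiameter σ N) (N + 1)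

/-- **Two-profile static change of measure** (helper statement `TwoProfileTransfer` of line
`rare-band-ladder-dock` v7): order-2 Rényi change of measure between local Gibbs laws with nearby
continuous profiles, `∫ G dλ₁ ≤ e^{δ(N+1)} (∫ G² dλ₂)^{1/2}`, with a tolerance `ρ` depending only
on the temperature range `[θm, θM]` and the budget `δ`. -/
def TwoProfileTransfer : Prop :=
  ∀ (θm θM : ℝ), 0 < θm → θm ≤ θM → ∀ δ : ℝ, 0 < δ → ∃ ρ : ℝ, 0 < ρ ∧
    ∀ (a₁ a₂ θ₁ θ₂ : T3 → ℝ) (u₁ u₂ : T3 → V3),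
    Continuous a₁ → Continuous a₂ → Continuous θ₁ → Continuous θ₂ → Continuous u₁ → Continuous u₂ →
    (∀ x, 0 < a₁ x) → (∀ x, 0 < a₂ x) →
    (∀ x, θm ≤ θ₁ x) → (∀ x, θ₁ x ≤ θM) → (∀ x, θm ≤ θ₂ x) → (∀ x, θ₂ x ≤ θM) →
    (∀ x, |Real.log (a₁ x) - Real.log (a₂ x)| ≤ ρ) → (∀ x, |θ₁ x - θ₂ x| ≤ ρ) → (∀ x, ‖u₁ x - u₂ x‖ ≤ ρ) →
    ∀ σ : ℝ, 0 < σ → σ ≤ 1 / 2 → ∀ (N : ℕ) (Φ : TFlow σ N) (G : Config (N + 1) (Fin 3) T3 → ℝ≥0∞), Measurable G →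
      ∫⁻ z, G z ∂(localGibbsLaw σ a₁ u₁ θ₁ N Φ) ≤
        ENNReal.ofReal (Real.exp (δ * ((N : ℝ) + 1))) *
          (∫⁻ z, G z ^ (2 : ℝ) ∂(localGibbsLaw σ a₂ u₂ θ₂ N Φ)) ^ (1 / 2 : ℝ)

/-- On `[θm, ∞)` the logarithm is `θm⁻¹`-Lipschitz, one-sided form: `|θ₁ − θ₂| ≤ ρ ≤ e θm` gives
`log θ₂ − log θ₁ ≤ e` (`θ₂ ≤ θ₁ + e θm ≤ (1 + e) θ₁ ≤ exp(e) θ₁`). [folklore] -/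
theorem log_sub_log_le_of_abs_sub_le {θm θ₁ θ₂ ρ e : ℝ} (hθm : 0 < θm) (h1 : θm ≤ θ₁)
    (h2 : θm ≤ θ₂) (he : 0 ≤ e) (hρ : ρ ≤ e * θm) (h : |θ₁ - θ₂| ≤ ρ) :
    Real.log θ₂ - Real.log θ₁ ≤ e := by
  have hθ1 : 0 < θ₁ := hθm.trans_le h1
  have hθ2 : 0 < θ₂ := hθm.trans_le h2
  have h12 : θ₂ ≤ Real.exp e * θ₁ := by
    have hab := (abs_le.1 h).1
    have hexp := Real.add_one_le_exp e
    nlinarith [mul_le_mul_of_nonneg_left h1 he, mul_le_mul_of_nonneg_right hexp hθ1.le]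
  have := Real.log_le_log hθ2 h12
  rw [Real.log_mul (Real.exp_pos e).ne' hθ1.ne', Real.log_exp] at this
  linarith

/-- On `[θm, ∞)` the inversion is `θm⁻²`-Lipschitz, one-sided form: `|θ₁ − θ₂| ≤ ρ ≤ e θm²`
gives `θ₂⁻¹ − θ₁⁻¹ = (θ₁ − θ₂)/(θ₁ θ₂) ≤ e`. [folklore] -/
theorem inv_sub_inv_le_of_abs_sub_le {θm θ₁ θ₂ ρ e : ℝ} (hθm : 0 < θm) (h1 : θm ≤ θ₁)
    (h2 : θm ≤ θ₂) (he : 0 ≤ e) (hρ : ρ ≤ e * θm ^ 2) (h : |θ₁ - θ₂| ≤ ρ) :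
    θ₂⁻¹ - θ₁⁻¹ ≤ e := by
  have hθ1 : 0 < θ₁ := hθm.trans_le h1
  have hθ2 : 0 < θ₂ := hθm.trans_le h2
  rw [inv_sub_inv hθ2.ne' hθ1.ne', div_le_iff₀ (mul_pos hθ2 hθ1)]
  have hab := (abs_le.1 h).2
  have hmm : θm ^ 2 ≤ θ₂ * θ₁ := by rw [sq]; exact mul_le_mul h2 h1 hθm.le hθ2.le
  nlinarith [mul_le_mul_of_nonneg_left hmm he]

/-- **Two-profile static Rényi bound, range form** (the landed two-profile statics
`LawChange.renyi_le_of_close` of `stub_staticFreezing`, with the tolerance made explicit). For a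
temperature range `0 < θm ≤ θM`, an order `p > 1` and a budget `δ > 0` there is `ρ > 0` such that for
any two continuous data `(aᵢ, θᵢ, uᵢ)` with `aᵢ > 0`, `θm ≤ θᵢ ≤ θM`, `ρ`-close in `(log a, θ, u)`
pointwise, every `0 < σ ≤ 1/2` and `N`: `∫ ψ₁^p ψ₂^{1-p} dL ≤ e^{pδ(N+1)}`. [folklore] -/
theorem twoProfile_renyi_le {θm θM : ℝ} (hθm0 : 0 < θm) (hθmM : θm ≤ θM) {p : ℝ} (hp : 1 < p)
    {δ : ℝ} (hδ : 0 < δ) :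
    ∃ ρ : ℝ, 0 < ρ ∧
    ∀ (a₁ a₂ θ₁ θ₂ : T3 → ℝ) (u₁ u₂ : T3 → V3),
    Continuous a₁ → Continuous a₂ → Continuous θ₁ → Continuous θ₂ → Continuous u₁ → Continuous u₂ →
    (∀ x, 0 < a₁ x) → (∀ x, 0 < a₂ x) →
    (∀ x, θm ≤ θ₁ x) → (∀ x, θ₁ x ≤ θM) → (∀ x, θm ≤ θ₂ x) → (∀ x, θ₂ x ≤ θM) →
    (∀ x, |Real.log (a₁ x) - Real.log (a₂ x)| ≤ ρ) → (∀ x, |θ₁ x - θ₂ x| ≤ ρ) →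
    (∀ x, ‖u₁ x - u₂ x‖ ≤ ρ) →
    ∀ σ : ℝ, 0 < σ → σ ≤ 1 / 2 → ∀ N : ℕ,
      ∫⁻ z, ENNReal.ofReal (canonicalDensity (Torus.geometry (Fin 3)) (hsDiameter σ N) (N + 1)
            (localGibbsProfile a₁ u₁ θ₁) z) ^ p *
          ENNReal.ofReal (canonicalDensity (Torus.geometry (Fin 3)) (hsDiameter σ N) (N + 1)
            (localGibbsProfile a₂ u₂ θ₂) z) ^ (1 - p)
        ∂(liouville (Torus.geometry (Fin 3)) (N + 1) (hsDiameter σ N)) ≤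
      ENNReal.ofReal (Real.exp (p * (δ * ((N : ℝ) + 1)))) := by
  have hΘ0 : 0 < θM := hθm0.trans_le hθmM
  obtain ⟨e, he0, he1, hBe, hKe⟩ :=
    KineticCurrentsWindowLDUniformSigmaUniform.StaticFreezing.exists_tolerance hp hδ
      (A := 7 / 2 + θm⁻¹) (B := (1 + θm⁻¹) * θM) (by positivity) (by positivity)
  refine ⟨min e (min (e * θm) (e * θm ^ 2)) / 2, by positivity, ?_⟩
  intro a₁ a₂ θ₁ θ₂ u₁ u₂ ha₁ ha₂ hθ₁ hθ₂ hu₁ hu₂ ha₁0 ha₂0 hθ₁m hθ₁M hθ₂m _hθ₂M hla hlθ hlu σ hσ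
    hσ2 N
  set ρ := min e (min (e * θm) (e * θm ^ 2)) / 2 with hρ
  have hm0 : min e (min (e * θm) (e * θm ^ 2)) ≤ e := min_le_left _ _
  have hm1 : min e (min (e * θm) (e * θm ^ 2)) ≤ e * θm :=
    (min_le_right _ _).trans (min_le_left _ _)
  have hm2 : min e (min (e * θm) (e * θm ^ 2)) ≤ e * θm ^ 2 :=
    (min_le_right _ _).trans (min_le_right _ _)
  have hρe : ρ < e := by rw [hρ]; linarith
  have hρ1 : ρ ≤ e / 2 * θm := by rw [hρ]; linarith
  have hρ2 : ρ ≤ e / 2 * θm ^ 2 := by rw [hρ]; linarith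
  have he2 : (0 : ℝ) ≤ e / 2 := (half_pos he0).le
  have he2' : e / 2 < e := half_lt_self he0
  have hθ₁0 : ∀ x, 0 < θ₁ x := fun x => hθm0.trans_le (hθ₁m x)
  have hθ₂0 : ∀ x, 0 < θ₂ x := fun x => hθm0.trans_le (hθ₂m x)
  have hlθ' : ∀ x, |θ₂ x - θ₁ x| ≤ ρ := fun x => by rw [abs_sub_comm]; exact hlθ x
  obtain ⟨Am, -, hAm⟩ := exists_forall_abs_le_of_continuous ha₁
  refine KineticCurrentsLDAlongFamiliesSketch.LawChange.renyi_le_of_close ha₁ hθ₁ hu₁ ha₂ hθ₂ hu₂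
    ha₁0 hθ₁0 ha₂0 hθ₂0 hσ hσ2 hp hθm0 hθ₂m hθ₁M (fun x => (le_abs_self _).trans (hAm x)) he0 he1
    hBe hKe (fun x => ?_) (fun x => ?_) (fun x => (hlu x).trans_lt hρe) (fun x => ?_) N
  · rw [abs_sub_comm]; exact (hla x).trans_lt hρe
  · refine lt_of_le_of_lt (abs_sub_le_iff.2 ⟨?_, ?_⟩) he2'
    · exact log_sub_log_le_of_abs_sub_le hθm0 (hθ₁m x) (hθ₂m x) he2 hρ1 (hlθ x)
    · exact log_sub_log_le_of_abs_sub_le hθm0 (hθ₂m x) (hθ₁m x) he2 hρ1 (hlθ' x)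
  · refine lt_of_le_of_lt (abs_sub_le_iff.2 ⟨?_, ?_⟩) he2'
    · exact inv_sub_inv_le_of_abs_sub_le hθm0 (hθ₁m x) (hθ₂m x) he2 hρ2 (hlθ x)
    · exact inv_sub_inv_le_of_abs_sub_le hθm0 (hθ₂m x) (hθ₁m x) he2 hρ2 (hlθ' x)

/-- **`stub_twoProfileTransfer`: the registered statement `TwoProfileTransfer` holds** —
Cauchy–Schwarz in `ℝ≥0∞` (`LawChange.lintegral_le_of_renyi_two`) against the two-profile order-2
Rényi bound (`twoProfile_renyi_le` with `p = 2`), and `(e^{2δ(N+1)})^{1/2} = e^{δ(N+1)}`.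
[folklore] -/
theorem stub_twoProfileTransfer : TwoProfileTransfer := by
  intro θm θM hθm hθmM δ hδ
  obtain ⟨ρ, hρ, h⟩ := twoProfile_renyi_le hθm hθmM one_lt_two hδ
  refine ⟨ρ, hρ, ?_⟩
  intro a₁ a₂ θ₁ θ₂ u₁ u₂ ha₁ ha₂ hθ₁ hθ₂ hu₁ hu₂ ha₁0 ha₂0 hθ₁m hθ₁M hθ₂m hθ₂M hla hlθ hlu σ hσ hσ2
    N Φ G hG
  have hθ₂0 : ∀ x, 0 < θ₂ x := fun x => hθm.trans_le (hθ₂m x)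
  have hH := KineticCurrentsLDAlongFamiliesSketch.LawChange.lintegral_le_of_renyi_two ha₁ hθ₁ hu₁
    ha₂ hθ₂ hu₂ ha₂0 hθ₂0 hσ2 Φ _
    (h a₁ a₂ θ₁ θ₂ u₁ u₂ ha₁ ha₂ hθ₁ hθ₂ hu₁ hu₂ ha₁0 ha₂0 hθ₁m hθ₁M hθ₂m hθ₂M hla hlθ hlu σ hσ hσ2 N)
    G hG.aemeasurable
  rw [KineticCurrentsLDAlongFamiliesSketch.LawChange.ofReal_exp_mul_rpow_inv two_pos] at hH
  simpa only [ENNReal.rpow_two] using hH.trans_eq (mul_comm _ _)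

end Summit.AtomisticToContinuum.HydrodynamicLimit.Theorems.KineticWindowGronwallTwoProfileTransfer

end
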